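import Summits.QuantumFields.YangMills.Theorems.BalabanUVNodesPortS1Spaces
import Summits.QuantumFields.YangMills.Theorems.BalabanUVNodesPortS1CfgGerm
import Summits.QuantumFields.YangMills.Theorems.BalabanUVNodesPortS1Chart
import Summits.QuantumFields.YangMills.Theorems.BalabanUVNodesPortU8IotaC2Transport
import Summits.QuantumFields.YangMills.Theorems.BalabanUVNodesK0RecordFormatNamesLDress

/-!
# NODE O port PT-A — THE GERM LIES IN EVERY RECORD SPACE (v3.4 glue `stub_LZdetGlue` of 27930, line `pta_residueW`): EVENTUALLY near `B = 0` the rooted (1.9) pair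
# `(U_{k+1}(W_B), J(U_{k+1}(W_B)))` = `recordPairJ … B` belongs to `U^c_{k+1}(X, α₀, α₁)` OF RECORD for EVERY domain `X` (positive radii, TokP9-reg shape)

Cell `ym-nodeO-ideate`, porter seat `ymgap-nodeO-port-PTA-1` (gen 8); `--supports stmt-QuantumFields-27930` (helper, P0-free).  [I] = [Balaban1987RG1], [15] = [Balaban1985Variational].
WHY.  The (63) germ identity ✓`eventually_phiLZdet_eq_sum_lzdetPiece` and row (b) read the P0-ℂ letter's (P4) Schur decay and `stub_G3C`'s (g3)(g5) AT THE GERM POINTS `recordPairJ … B`; those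
clauses are granted on the record spaces `recordUc … Y` only — this file puts the germ there.
* §1 `continuousAt_recordCurrent` (the (1.8) current of the rooted background field is continuous at `B = 0`, via ✓`PortU8.contDiffAt_current`), `continuousAt_plaq_recordBgUnits`,
  `eventually_norm_recordCurrent_lt`, `eventually_norm_plaq_recordBgUnits_sub_one_lt`.
* §2 ★ `satisfies_recordPair` — a bondwise `SU(2)`-valued `𝐔` with `‖𝐔(b) − 1‖ < min ½ (α₁ξ²∕8)`, plaquettes `‖∂𝐔 − 1‖ < α₀ξ²` on `X`, and a traceless `𝐉` with `‖𝐉‖ < α₀` on `X` satisfies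
  (i)–(iv) of record with `U := 1`, `A′ := (iξ)⁻¹ log 𝐔` (the template is dag-n07-e's ✓`K0PortChart44DMapsTo.satisfies_chartPair`).
* §3 ★★★ `eventually_encodeCfg_recordPairJ_mem_recordUc` — `∀ᶠ B in 𝓝 0, ∀ X, encodeCfg (recordPairJ F θ k K B) ∈ recordUc F Mc k α₀ α₁ K X` (`0 < α₀`, `0 < α₁`, `k + 1 ≤ m + K`);
  `…_at` = the same at the texts' letters `θ := thetaFill F a₀ ε₂₉`, `K := recordK₀ F Mc k + n`.

HONEST FRAMING.  Continuity bookkeeping over the tree's own objects; NOTHING of Bałaban's estimates asserted, ported or discharged; the TokP9-reg shape is ⁸'s own antecedent; `stub_P0C` ∕ `stub_G3C` ∕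
`stub_LZdetGlue` ∕ `stub_FE` OPEN; 27930 OPEN (2∕6 stubs by name) · no claim; NODE O 0∕1; COUNT 8∕28 · K 1∕4 UNMOVED; finite `𝕋⁴_{L^K}` at fixed ε — NOT continuum ∕ OS ∕ Clay; **the Yang–Mills mass
gap is NOT proved by any of this.**  No `sorry`, no `def`, no `instance`, no `notation`; standard axioms.
-/

noncomputable section

open scoped BigOperators Matrix.Norms.L2Operator Topology
open Filter

namespace Summit.QuantumFields.YangMills.Theorems.BalabanUVNodesPortS1

open Summit.QuantumFields.YangMills.Theorems.K0RecordFormatNames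
open Literature.MathematicalPhysics.QuantumFieldTheory.Balaban1983to89
open Literature.MathematicalPhysics.QuantumFieldTheory.Balaban1983to89.Node00
open Literature.MathematicalPhysics.QuantumFieldTheory.Balaban1983to89.T4Continuum (T4Family)
open Summit.QuantumFields.YangMills.Theorems.PortU8 (contDiff_star' contDiffAt_current coe_recordBgUnits_inv contDiffAt_matrix_of_entries_analyticAt)

variable (F : T4Family) (θ : Stage13Params F 2)

/-! ## §1  Continuity at `B = 0` of the current and of the plaquette variables of the rooted background field -/

/-- **The (1.8) current of the rooted background field is continuous at `B = 0`** (TokP9-reg shape ⟹ `C⁰` of the bond matrices and their inverses `= adjoints`; ✓`PortU8.contDiffAt_current`).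
[cite: Balaban1987RG1, (1.8) p.261; Balaban1985Variational, Prop. 9 p.309] -/
theorem continuousAt_recordCurrent (k K : ℕ)
    (hP9 : letI := θ.instVβ₁; letI := θ.instVβ₂
      AnalyticAt ℝ (fun B : Fin (F.P K).d → Site (F.P K) (k + 1) → θ.Vβ => fun (b : PBond (F.P K) 0) (i i' : Fin 2) =>
        ((recordBgField F θ k K B b : SU 2) : Matrix (Fin 2) (Fin 2) ℂ) i i') 0)
    (b : PBond (F.P K) 0) :
    letI := θ.instVβ₁; letI := θ.instVβ₂
    ContinuousAt (fun B : Fin (F.P K).d → Site (F.P K) (k + 1) → θ.Vβ => recordCurrent F θ k K B b) 0 := by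
  letI := θ.instVβ₁; letI := θ.instVβ₂
  have hmat : ContDiffAt ℝ 0 (fun B : Fin (F.P K).d → Site (F.P K) (k + 1) → θ.Vβ => fun b : PBond (F.P K) 0 => ((recordBgField F θ k K B b : SU 2) : MatA 2)) 0 :=
    contDiffAt_matrix_of_entries_analyticAt hP9
  have hb : ∀ b, ContDiffAt ℝ 0 (fun B : Fin (F.P K).d → Site (F.P K) (k + 1) → θ.Vβ => ((recordBgField F θ k K B b : SU 2) : MatA 2)) 0 :=
    fun b => contDiffAt_pi.1 hmat b
  have hW : ∀ b, ContDiffAt ℝ 0 (fun B : Fin (F.P K).d → Site (F.P K) (k + 1) → θ.Vβ => ((recordBgUnits F θ k K B b : (MatA 2)ˣ) : MatA 2)) 0 := hb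
  have hW' : ∀ b, ContDiffAt ℝ 0 (fun B : Fin (F.P K).d → Site (F.P K) (k + 1) → θ.Vβ => (((recordBgUnits F θ k K B b)⁻¹ : (MatA 2)ˣ) : MatA 2)) 0 := by
    intro b
    simp only [coe_recordBgUnits_inv]
    exact contDiff_star'.contDiffAt.comp 0 (hb b)
  exact (contDiffAt_current hW hW' sl2Proj ((F.P K).eta (k + 1)) b).continuousAt

/-- **The plaquette variables of the rooted background field are continuous at `B = 0`** (products of bond matrices and their adjoints). [cite: Balaban1987RG1, (1.11) p.262; Balaban1985Variational, Prop. 9 p.309] -/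
theorem continuousAt_plaq_recordBgUnits (k K : ℕ)
    (hP9 : letI := θ.instVβ₁; letI := θ.instVβ₂
      AnalyticAt ℝ (fun B : Fin (F.P K).d → Site (F.P K) (k + 1) → θ.Vβ => fun (b : PBond (F.P K) 0) (i i' : Fin 2) =>
        ((recordBgField F θ k K B b : SU 2) : Matrix (Fin 2) (Fin 2) ℂ) i i') 0)
    (p : Plaq (F.P K) 0) :
    letI := θ.instVβ₁; letI := θ.instVβ₂
    ContinuousAt (fun B : Fin (F.P K).d → Site (F.P K) (k + 1) → θ.Vβ => ((B12RegularSpaces111.plaq (recordBgUnits F θ k K B) p : (MatA 2)ˣ) : MatA 2)) 0 := by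
  letI := θ.instVβ₁; letI := θ.instVβ₂
  have hc : ∀ b, ContinuousAt (fun B : Fin (F.P K).d → Site (F.P K) (k + 1) → θ.Vβ => ((recordBgUnits F θ k K B b : (MatA 2)ˣ) : MatA 2)) 0 :=
    fun b => continuousAt_recordBgField_of_analyticAt F θ k K hP9 b
  have hc' : ∀ b, ContinuousAt (fun B : Fin (F.P K).d → Site (F.P K) (k + 1) → θ.Vβ => (((recordBgUnits F θ k K B b)⁻¹ : (MatA 2)ˣ) : MatA 2)) 0 := by
    intro b
    simp only [coe_recordBgUnits_inv]
    exact (hc b).star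
  simp only [B12RegularSpaces111.plaq_eq, Units.val_mul]
  exact (((hc _).mul (hc _)).mul (hc' _)).mul (hc' _)

/-- **Eventual smallness of the current**: `‖J(U_{k+1}(W_B))(b)‖ < γ` on every fine bond, eventually near `B = 0` (`γ > 0`; the current vanishes at `B = 0`).
[cite: Balaban1987RG1, (1.8) p.261, (1.14) p.262; Balaban1985Variational, Prop. 9 p.309] -/
theorem eventually_norm_recordCurrent_lt {k K : ℕ} (hk : k + 1 ≤ (F.P K).m + (F.P K).K)
    (hP9 : letI := θ.instVβ₁; letI := θ.instVβ₂
      AnalyticAt ℝ (fun B : Fin (F.P K).d → Site (F.P K) (k + 1) → θ.Vβ => fun (b : PBond (F.P K) 0) (i i' : Fin 2) =>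
        ((recordBgField F θ k K B b : SU 2) : Matrix (Fin 2) (Fin 2) ℂ) i i') 0)
    {γ : ℝ} (hγ : 0 < γ) :
    letI := θ.instVβ₁; letI := θ.instVβ₂
    ∀ᶠ B in 𝓝 (0 : Fin (F.P K).d → Site (F.P K) (k + 1) → θ.Vβ), ∀ b : PBond (F.P K) 0, ‖recordCurrent F θ k K B b‖ < γ := by
  letI := θ.instVβ₁; letI := θ.instVβ₂
  refine Filter.eventually_all.mpr fun b => ?_
  have hc := continuousAt_recordCurrent F θ k K hP9 b
  have h0 : recordCurrent F θ k K (0 : Fin (F.P K).d → Site (F.P K) (k + 1) → θ.Vβ) b = 0 := by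
    rw [recordCurrent_zero F θ hk]; rfl
  have hev := (Metric.tendsto_nhds.mp hc) γ hγ
  filter_upwards [hev] with B hB
  rwa [dist_eq_norm, h0, sub_zero] at hB

/-- **Eventual smallness of the plaquette variables**: `‖∂U_{k+1}(W_B)(p) − 1‖ < γ` on every fine plaquette, eventually near `B = 0` (`γ > 0`; `∂1 = 1`).
[cite: Balaban1987RG1, (1.11) p.262, (1.14) p.262; Balaban1985Variational, Prop. 9 p.309] -/
theorem eventually_norm_plaq_recordBgUnits_sub_one_lt {k K : ℕ} (hk : k + 1 ≤ (F.P K).m + (F.P K).K)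
    (hP9 : letI := θ.instVβ₁; letI := θ.instVβ₂
      AnalyticAt ℝ (fun B : Fin (F.P K).d → Site (F.P K) (k + 1) → θ.Vβ => fun (b : PBond (F.P K) 0) (i i' : Fin 2) =>
        ((recordBgField F θ k K B b : SU 2) : Matrix (Fin 2) (Fin 2) ℂ) i i') 0)
    {γ : ℝ} (hγ : 0 < γ) :
    letI := θ.instVβ₁; letI := θ.instVβ₂
    ∀ᶠ B in 𝓝 (0 : Fin (F.P K).d → Site (F.P K) (k + 1) → θ.Vβ), ∀ p : Plaq (F.P K) 0,
      ‖((B12RegularSpaces111.plaq (recordBgUnits F θ k K B) p : (MatA 2)ˣ) : MatA 2) - 1‖ < γ := by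
  letI := θ.instVβ₁; letI := θ.instVβ₂
  refine Filter.eventually_all.mpr fun p => ?_
  have hc := continuousAt_plaq_recordBgUnits F θ k K hP9 p
  have h0 : ((B12RegularSpaces111.plaq (recordBgUnits F θ k K (0 : Fin (F.P K).d → Site (F.P K) (k + 1) → θ.Vβ)) p : (MatA 2)ˣ) : MatA 2) = 1 := by
    have h1 : recordBgUnits F θ k K (0 : Fin (F.P K).d → Site (F.P K) (k + 1) → θ.Vβ) = 1 := recordBgUnits_zero F θ hk
    rw [h1, B12RegularSpaces111.plaq_eq]
    simp
  have hev := (Metric.tendsto_nhds.mp hc) γ hγ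
  filter_upwards [hev] with B hB
  rwa [dist_eq_norm, h0] at hB

/-! ## §2  A near-unit `SU(2)`-valued `𝐔` with small plaquettes and a small traceless `𝐉` satisfies (i)–(iv) of record -/

/-- ★ **A NEAR-UNIT PAIR SATISFIES (i)–(iv) OF RECORD**: `𝐔` bondwise `SU(2)`-valued with `‖𝐔(b) − 1‖ < min ½ (α₁ξ²∕8)` on every bond, `‖∂𝐔(p) − 1‖ < α₀ξ²` on the plaquettes inside `X`, `𝐉` traceless
with `‖𝐉(b)‖ < α₀` on the bonds in `X` ⟹ `Satisfies` on the frame of record of `X` with radii `(α₀, α₁, γ₀ := α₀)`, factorisation `U := 1`, `A′ := (iξ)⁻¹ log 𝐔` (`|A′| ≤ 2ξ⁻¹|𝐔 − 1| < α₁`,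
`|∇A′| ≤ 4ξ⁻²|𝐔 − 1| < α₁`; (1.12) and (iv) trivial at `U = 1` ∕ the unit recipe). [cite: Balaban1987RG1, (1.11)–(1.16) p.262; Balaban1985Variational, Prop. 9 p.309 («minimal configurations satisfy the conditions»)] -/
theorem satisfies_recordPair (Mc k K : ℕ) (X : (recordDomSys F Mc k K).Dom) {α₀ α₁ : ℝ} (hα₀ : 0 < α₀) (hα₁ : 0 < α₁)
    (U : GaugeField (F.P K) 0 (SU 2)) (J : PBond (F.P K) 0 → MatA 2)
    (hU : ∀ b, ‖((U b : SU 2) : MatA 2) - 1‖ < min (1 / 2) (α₁ * (F.P K).eta (k + 1) ^ 2 / 8))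
    (hplaq : ∀ p ∈ (Sect2.regionOfSet (F.P K) (Sect2.domSites (F.P K) Mc (k + 1) X)).plaqs,
      ‖((B12RegularSpaces111.plaq (fun b => ιSU 2 (U b)) p : (MatA 2)ˣ) : MatA 2) - 1‖ < α₀ * (F.P K).eta (k + 1) ^ 2)
    (hJtr : ∀ b, (J b).trace = 0) (hJlt : ∀ b, ‖J b‖ < α₀) :
    B12RegularSpaces111.Satisfies (B12RegularSpaces111SpecialUnitary.suModel 2)
      (Sect2.frameI (RzOfRecord F 2 K) Mc (k + 1) (Sect2.domSites (F.P K) Mc (k + 1) X))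
      (B12RegularSpaces111.StepConsts.ofParams (F.P K) (recordCB F) (k + 1)) α₀ α₁ α₀ ⟨fun b => ιSU 2 (U b), J⟩ := by
  set ξ : ℝ := (F.P K).eta (k + 1) with hξdef
  have hξ : 0 < ξ := pow_pos (inv_pos.mpr (Nat.cast_pos.mpr (F.P K).L_pos)) _
  have hξ1 : ξ ≤ 1 := K0PortChart44DMapsTo.eta_le_one F K (k + 1)
  have hIξ : (Complex.I * (ξ : ℂ)) ≠ 0 := mul_ne_zero Complex.I_ne_zero (by exact_mod_cast hξ.ne')
  have hnIξ : ‖(Complex.I * (ξ : ℂ))⁻¹‖ = ξ⁻¹ := by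
    rw [norm_inv, norm_mul, Complex.norm_I, one_mul, Complex.norm_real, Real.norm_of_nonneg hξ.le]
  have hcB : 0 < recordCB F * α₀ := mul_pos (PortU2.recordCB_pos F) hα₀
  have hU2 : ∀ b, ‖((U b : SU 2) : MatA 2) - 1‖ ≤ 1 / 2 := fun b => ((hU b).trans_le (min_le_left _ _)).le
  have hU8 : ∀ b, ‖((U b : SU 2) : MatA 2) - 1‖ < α₁ * ξ ^ 2 / 8 := fun b => (hU b).trans_le (min_le_right _ _)
  -- the logarithm A′ := (iξ)⁻¹ log 𝐔 and its bound
  set A' : PBond (F.P K) 0 → MatA 2 := fun b => (Complex.I * (ξ : ℂ))⁻¹ • MatrixLog.mlog ((U b : SU 2) : MatA 2) with hA'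
  have hA'b : ∀ b, ‖A' b‖ ≤ 2 * ξ⁻¹ * ‖((U b : SU 2) : MatA 2) - 1‖ := fun b => by
    simp only [hA', norm_smul, hnIξ]
    have := MatrixLog.norm_mlog_le_two_mul (hU2 b)
    calc ξ⁻¹ * ‖MatrixLog.mlog ((U b : SU 2) : MatA 2)‖ ≤ ξ⁻¹ * (2 * ‖((U b : SU 2) : MatA 2) - 1‖) := mul_le_mul_of_nonneg_left this (inv_nonneg.2 hξ.le)
      _ = 2 * ξ⁻¹ * ‖((U b : SU 2) : MatA 2) - 1‖ := by ring
  have hA'lt : ∀ b, ‖A' b‖ < α₁ * ξ / 4 := fun b => by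
    calc ‖A' b‖ ≤ 2 * ξ⁻¹ * ‖((U b : SU 2) : MatA 2) - 1‖ := hA'b b
      _ < 2 * ξ⁻¹ * (α₁ * ξ ^ 2 / 8) := mul_lt_mul_of_pos_left (hU8 b) (by positivity)
      _ = α₁ * ξ / 4 := by field_simp; ring
  refine ⟨fun b _ => ?_, fun b _ => B12RegularSpaces111SpecialUnitary.mem_suModel_gc.2 (hJtr b), 1, A', fun b => ?_, ?_, ?_, ?_,
    K0PortChart44DMapsTo.condIV_record F Mc k K X hα₀ _, K0PortChart44DMapsTo.condIV_record F Mc k K X hα₀ _⟩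
  · -- `𝐔` is `Gᶜ`-valued
    exact B12RegularSpaces111SpecialUnitary.suModel_G_le_Gc (ιSU_mem_G 2 (U b))
  · -- the factorisation `𝐔 = exp iξA′ · 1`
    rw [Pi.one_apply, mul_one]
    refine Units.ext ?_
    simp only [hA', B12RegularSpaces111.expI, B12RegularSpaces111.StepConsts.ofParams, smul_smul, Beta.BackgroundVertices.val_expUnit, coe_ιSU]
    rw [← hξdef, mul_inv_cancel₀ hIξ, one_smul]
    exact (MatrixLog.exp_mlog ((hU2 b).trans_lt (by norm_num))).symm
  · -- (i) for `U = 1`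
    refine ⟨fun b _ => (B12RegularSpaces111SpecialUnitary.suModel 2).G.one_mem, fun p _ => ?_, fun C _ => ?_⟩
    · rw [B12RegularSpaces111.plaq_eq]
      simp only [Pi.one_apply, inv_one, mul_one, Units.val_one, sub_self, norm_zero, B12RegularSpaces111.StepConsts.ofParams]
      positivity
    · refine ⟨1, fun _ => (B12RegularSpaces111SpecialUnitary.suModel 2).G.one_mem, 0, fun b _ => ?_, fun b _ => ?_, fun q _ => ?_⟩
      · simp only [B12RegularSpaces111.gaugeU, Pi.one_apply, inv_one, mul_one, Pi.zero_apply, B12RegularSpaces111.expI, smul_zero]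
        exact Units.ext (by simp)
      · simpa only [Pi.zero_apply, norm_zero, B12RegularSpaces111.StepConsts.ofParams] using hcB
      · simpa only [B12RegularSpaces111.grad, Pi.zero_apply, sub_self, smul_zero, norm_zero, B12RegularSpaces111.StepConsts.ofParams] using hcB
  · -- (ii) for `A′` in the background `U = 1`
    refine ⟨fun b _ => ?_, fun b _ => ?_, fun q _ => ?_⟩
    · exact Submodule.smul_mem _ _ (B12RegularSpaces111SpecialUnitary.mem_suModel_gc.2 (trace_mlog_eq_zero_of_SU2 (U b) (hU2 b)))
    · calc ‖A' b‖ < α₁ * ξ / 4 := hA'lt b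
        _ ≤ α₁ := by nlinarith
    · rw [B12RegularSpaces111.nabla_one]
      simp only [B12RegularSpaces111.grad, B12RegularSpaces111.StepConsts.ofParams]
      rw [norm_smul, norm_inv, Complex.norm_real, Real.norm_of_nonneg hξ.le]
      calc ξ⁻¹ * ‖A' ⟨q.1.shift q.2.1, q.2.2⟩ - A' ⟨q.1, q.2.2⟩‖
          ≤ ξ⁻¹ * (‖A' ⟨q.1.shift q.2.1, q.2.2⟩‖ + ‖A' ⟨q.1, q.2.2⟩‖) := mul_le_mul_of_nonneg_left (norm_sub_le _ _) (inv_nonneg.2 hξ.le)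
        _ < ξ⁻¹ * (α₁ * ξ / 4 + α₁ * ξ / 4) := mul_lt_mul_of_pos_left (add_lt_add (hA'lt _) (hA'lt _)) (inv_pos.2 hξ)
        _ = α₁ / 2 := by field_simp; ring
        _ ≤ α₁ := by linarith
  · -- (iii)
    refine ⟨fun p hp => ?_, fun b _ => hJlt b⟩
    simp only [B12RegularSpaces111.StepConsts.ofParams]
    exact hplaq p hp

/-! ## §3  ★★★ The germ lies in every record space -/

/-- ★★★ **EVENTUALLY near `B = 0`, the rooted (1.9) pair lies in `U^c_{k+1}(X, α₀, α₁)` OF RECORD for EVERY domain `X`** (`0 < α₀`, `0 < α₁`, standing range `k + 1 ≤ m + K`, TokP9-reg shape):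
the bond matrices tend to `1`, the plaquette variables to `1`, the current to `0` (§1), and a near-unit pair satisfies (i)–(iv) (§2) — its own orbit (`u = 1`).
[cite: Balaban1987RG1, (1.11)–(1.16) p.262, p.263 L5–13, (1.9) p.261; Balaban1985Variational, Prop. 9 p.309] -/
theorem eventually_encodeCfg_recordPairJ_mem_recordUc (Mc : ℕ) {k K : ℕ} (hk : k + 1 ≤ (F.P K).m + (F.P K).K)
    (hP9 : letI := θ.instVβ₁; letI := θ.instVβ₂
      AnalyticAt ℝ (fun B : Fin (F.P K).d → Site (F.P K) (k + 1) → θ.Vβ => fun (b : PBond (F.P K) 0) (i i' : Fin 2) =>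
        ((recordBgField F θ k K B b : SU 2) : Matrix (Fin 2) (Fin 2) ℂ) i i') 0)
    {α₀ α₁ : ℝ} (hα₀ : 0 < α₀) (hα₁ : 0 < α₁) :
    letI := θ.instVβ₁; letI := θ.instVβ₂
    ∀ᶠ B in 𝓝 (0 : Fin (F.P K).d → Site (F.P K) (k + 1) → θ.Vβ), ∀ X : (recordDomSys F Mc k K).Dom,
      encodeCfg F K (recordPairJ F θ k K B) ∈ recordUc F Mc k α₀ α₁ K X := by
  letI := θ.instVβ₁; letI := θ.instVβ₂
  have hξ : 0 < (F.P K).eta (k + 1) := pow_pos (inv_pos.mpr (Nat.cast_pos.mpr (F.P K).L_pos)) _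
  have hδ : 0 < min (1 / 2) (α₁ * (F.P K).eta (k + 1) ^ 2 / 8) := lt_min (by norm_num) (by positivity)
  filter_upwards [eventually_norm_recordBgField_sub_one_lt F θ hk hP9 hδ, eventually_norm_recordCurrent_lt F θ hk hP9 hα₀,
    eventually_norm_plaq_recordBgUnits_sub_one_lt F θ hk hP9 (by positivity : 0 < α₀ * (F.P K).eta (k + 1) ^ 2)] with B hU hJ hp X
  have hSat := satisfies_recordPair F Mc k K X hα₀ hα₁ (recordBgField F θ k K B) (recordCurrent F θ k K B) hU (fun p _ => hp p)
    (trace_recordCurrent F θ k K B) hJ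
  rw [encodeCfg_mem_recordUc_iff]
  exact ⟨_, B12RegularSpaces111.mem_space_of_satisfies hSat, rfl⟩

/-- The same AT THE TEXTS' LETTERS (`θ := thetaFill F a₀ ε₂₉`, `K := recordK₀ F Mc k + n`; the TokP9-reg token's body at `(k, n, ε₂₉)`).
[cite: Balaban1987RG1, (1.11)–(1.16) p.262, (1.9) p.261; Balaban1985Variational, Prop. 9 p.309 (bookkeeping)] -/
theorem eventually_encodeCfg_recordPairJ_mem_recordUc_at (a₀ ε₂₉ : ℝ) (Mc k n : ℕ)
    (hP9 : letI θ := thetaFill F a₀ ε₂₉; letI := θ.instVβ₁; letI := θ.instVβ₂; letI := θ.instιβ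
      AnalyticAt ℝ (fun B : recordW F a₀ ε₂₉ k (recordK₀ F Mc k + n) => fun (b : PBond (F.P (recordK₀ F Mc k + n)) 0) (i i' : Fin 2) =>
        ((recordBgField F θ k (recordK₀ F Mc k + n) B b : SU 2) : Matrix (Fin 2) (Fin 2) ℂ) i i') 0)
    {α₀ α₁ : ℝ} (hα₀ : 0 < α₀) (hα₁ : 0 < α₁) :
    letI θ := thetaFill F a₀ ε₂₉; letI := θ.instVβ₁; letI := θ.instVβ₂; letI := θ.instιβ
    ∀ᶠ B in 𝓝 (0 : recordW F a₀ ε₂₉ k (recordK₀ F Mc k + n)), ∀ X : (recordDomSys F Mc k (recordK₀ F Mc k + n)).Dom,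
      encodeCfg F (recordK₀ F Mc k + n) (recordPairJ F θ k (recordK₀ F Mc k + n) B) ∈ recordUc F Mc k α₀ α₁ (recordK₀ F Mc k + n) X :=
  eventually_encodeCfg_recordPairJ_mem_recordUc F (thetaFill F a₀ ε₂₉) Mc (succ_le_m_add_K_recordK₀ F Mc k n) hP9 hα₀ hα₁

end Summit.QuantumFields.YangMills.Theorems.BalabanUVNodesPortS1

end
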